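import Summits.QuantumFields.QCD.Theses.SpectralDefectExtinction
import Summits.QuantumFields.QCD.Theorems.ExtinctionBuildsQCD.Negative.WithoutTightCollapse
import Summits.QuantumFields.QCD.Theorems.WindowExtinction.Negative.SpectralFlowLocal
import Summits.QuantumFields.QCD.Theorems.WindowExtinction.Negative.SpectralFlow
import Summits.QuantumFields.QCD.Theorems.SpectralDefectExtinctionTipPricingStubCoareaPointwiseAux
import Literature.MathematicalPhysics.QuantumFieldTheory.QCDPhaseQuenched
import Literature.MathematicalPhysics.QuantumFieldTheory.SpectralDefectDensity
import Literature.LinearAlgebra.Matrix.HermitianEigenvaluePerturbation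

/-!
# Stub `stub_coareaPointwise` of line `hermitian-flow-coarea`
(crux `Summit.QuantumFields.QCD.Theses.SpectralDefectExtinction.TipPricing`, item stmt-QuantumFields-8967)

**What is proved.**  For every torus side `L ≥ 1`, every `SU(3)` lattice gauge field `U` and every open
interval `(t₁, t₂)` there is `ε₀ = ε₀(U) > 0` such that for all `0 < ε < ε₀`

  `2ε · #{real eigenvalues of D_W(U,0,1) in (t₁,t₂)} ≤ ∫_{t₁}^{t₂} N_U(t, ε) dt`,

where `D_W(U,0,1) = wilsonDirac (fundamentalRep (Fin 3)) U 0 1` is the massless `r = 1` Wilson–Dirac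
matrix (real eigenvalues counted WITH algebraic multiplicity, as roots of the characteristic polynomial)
and `N_U(t, ε) = #{eigenvalues of H_U(t) in (−ε, ε)}` is the zero-window level count of the Hermitian
Wilson flow `H_U(t) := Γ₅ D_W(U,−t,1) = Γ₅ D_W(U,0,1) − t Γ₅` (`hermitianWilsonDirac_eq_pencil`).

**Proof.**  (i) `H_U(t') − H_U(t) = (t − t')Γ₅` with `Γ₅` a Hermitian unitary, so
`‖(H_U(t') − H_U(t))x‖ = |t' − t| ‖x‖`; by Weyl's inequality in window-counting form
(`coareaPt_card_window_le`, Aux file) the window count `t ↦ N_U(t,ε)` is lower semicontinuous, hence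
Borel, bounded by `12L⁴`, so interval integrable (the interval integral is an honest Bochner integral).
(ii) Let `λ` be a real eigenvalue of `D := D_W(U,0,1)` in `(t₁,t₂)` of algebraic multiplicity
`k = D.charpoly.roots.count λ` and let `g = #{zero eigenvalues of H_U(λ)} ≤ k` (`pencil_zero_count_le`:
nullity of `Γ₅(D − λ)` ≤ algebraic multiplicity).  If `g = k`, the `k` zero modes of `H_U(λ)` give `k`
eigenvalues of `H_U(t)` in `(−ε, ε)` for `|t − λ| < ε`.  If `g < k`, then
`|det H_U(t)| = |det Γ₅| |det(D − t)| = |charpoly_D(t)| ≤ C|t − λ|^k` (`det_spinorLift_gammaFive`,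
`Matrix.eval_charpoly`, factor `(X − λ)^k` of the characteristic polynomial and compactness), while the
`n − g` non-zero branches stay `≥ γ/2` away from `0` for `|t − λ| < γ/2` (`γ` the spectral gap of
`H_U(λ)`); so if NO eigenvalue of `H_U(t)` were in `(−ε, ε)` we would get `ε^g (min 1 γ/2)^n ≤ C|t−λ|^k`,
impossible on `|t − λ| < kε` once `ε` is small (`k − g ≥ 1`).  Either way (`coareaPt_root_window`) there
are `c ∈ ℕ`, `0 < w ≤ kε` with `c·w = kε` and `N_U(t,ε) ≥ c` on `|t − λ| < w`.  (iii) The finitely many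
distinct real eigenvalues in the open interval have, for `ε < ε₀(U)`, pairwise disjoint windows inside
`(t₁,t₂)` (all thresholds are collected as a right-neighbourhood filter statement at `ε = 0`); the step
function `Σ_λ c_λ 1_{(λ − w_λ, λ + w_λ)}` minorises `N_U(·,ε)` and integrates to `Σ_λ 2εk_λ = 2ε · #real`
(`coareaPt_sum_le_integral`).

Sources: T. Kato, *Perturbation Theory for Linear Operators*, Ch. II §§5–6 (Lipschitz eigenvalue
branches of a symmetric family); R. G. Edwards, U. M. Heller, R. Narayanan, Nucl. Phys. B 535 (1998) 403,
§§1–3 (zero crossings of `γ₅ W(−m)` ⟺ real modes of the Wilson operator).  Tree facts used: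
`isHermitian_gammaFive_mul_wilsonDirac`, `spinorLift_gammaFive_mul_self`, `det_spinorLift_gammaFive`,
`wilsonDirac_mass_eq_add_scalar`, `hermitianWilsonDirac_eq_pencil`, `pencil_zero_count_le`,
`countP_roots_eq_card_filter`, `sum_norm_sq_mulVec_of_isometry` (all proved), and Mathlib.
-/

noncomputable section

namespace Summit.QuantumFields.QCD.Cruxes.TipPricing.HermitianFlowCoarea

section MeasurePart

open MeasureTheory Set Filter Topology

/-- A bounded Borel function `ℝ → ℝ` is interval integrable. -/
theorem coareaPt_intervalIntegrable_of_bounded {f : ℝ → ℝ} (hf : Measurable f) {M : ℝ}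
    (hM : ∀ t, ‖f t‖ ≤ M) (a b : ℝ) : IntervalIntegrable f volume a b := by
  constructor <;>
    exact Measure.integrableOn_of_bounded measure_Ioc_lt_top.ne hf.aestronglyMeasurable
      (ae_of_all _ hM)

/-- **Disjoint windows under the graph.** If `f ≥ 0` is interval integrable on `[t₁, t₂]` and dominates
the constant `c_z` on the window `(cen_z - w_z, cen_z + w_z) ⊆ [t₁, t₂]` for each `z ∈ Z`, the windows
being pairwise disjoint, then `Σ_z 2 w_z c_z ≤ ∫_{t₁}^{t₂} f`. -/
theorem coareaPt_sum_le_integral {ι : Type*} (Z : Finset ι) (cen w : ι → ℝ) (c : ι → ℕ)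
    {t₁ t₂ : ℝ} (ht : t₁ ≤ t₂) {f : ℝ → ℝ} (hf : IntervalIntegrable f volume t₁ t₂)
    (hf0 : ∀ t, 0 ≤ f t) (hw : ∀ z ∈ Z, 0 ≤ w z)
    (hin : ∀ z ∈ Z, t₁ ≤ cen z - w z ∧ cen z + w z ≤ t₂)
    (hsep : ∀ z ∈ Z, ∀ z' ∈ Z, z ≠ z' → w z + w z' ≤ |cen z - cen z'|)
    (hcf : ∀ z ∈ Z, ∀ t, |t - cen z| < w z → (c z : ℝ) ≤ f t) :
    ∑ z ∈ Z, (c z : ℝ) * (2 * w z) ≤ ∫ t in t₁..t₂, f t := by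
  -- the step minorant
  set g : ι → ℝ → ℝ := fun z => (Ioo (cen z - w z) (cen z + w z)).indicator fun _ => (c z : ℝ) with hg
  have hgI : ∀ z ∈ Z, IntervalIntegrable (g z) volume t₁ t₂ := fun z _ =>
    coareaPt_intervalIntegrable_of_bounded (measurable_const.indicator measurableSet_Ioo) (M := c z)
      (fun t => (norm_indicator_le_norm_self _ t).trans (by rw [Real.norm_natCast])) t₁ t₂
  have hgint : ∀ z ∈ Z, ∫ t in t₁..t₂, g z t = (c z : ℝ) * (2 * w z) := by
    intro z hz
    have hsub : Ioo (cen z - w z) (cen z + w z) ⊆ Ioc t₁ t₂ :=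
      (Ioo_subset_Ioo (hin z hz).1 (hin z hz).2).trans Ioo_subset_Ioc_self
    rw [intervalIntegral.integral_of_le ht, hg]
    dsimp only
    rw [integral_indicator measurableSet_Ioo, Measure.restrict_restrict measurableSet_Ioo,
      inter_eq_left.2 hsub, setIntegral_const, smul_eq_mul,
      Real.volume_real_Ioo_of_le (by linarith [hw z hz])]
    ring
  -- pointwise domination
  have hle : ∀ t ∈ Icc t₁ t₂, (fun t => ∑ z ∈ Z, g z t) t ≤ f t := by
    intro t _
    dsimp only
    by_cases h : ∃ z ∈ Z, t ∈ Ioo (cen z - w z) (cen z + w z)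
    · obtain ⟨z, hz, hzt⟩ := h
      have hzt' : |t - cen z| < w z := by
        rw [abs_sub_lt_iff]; rw [mem_Ioo] at hzt; constructor <;> linarith
      rw [Finset.sum_eq_single_of_mem z hz]
      · rw [hg]; dsimp only; rw [indicator_of_mem hzt]
        exact hcf z hz t hzt'
      · intro z' hz' hne
        rw [hg]; dsimp only
        refine indicator_of_notMem (fun hzt2 => ?_) _
        have h2 : |t - cen z'| < w z' := by
          rw [abs_sub_lt_iff]; rw [mem_Ioo] at hzt2; constructor <;> linarith
        have h3 := hsep z hz z' hz' (Ne.symm hne)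
        have h4 : |cen z - cen z'| ≤ |cen z - t| + |t - cen z'| := abs_sub_le _ _ _
        rw [abs_sub_comm (cen z) t] at h4
        linarith
    · push Not at h
      rw [Finset.sum_eq_zero fun z hz => ?_]
      · exact hf0 t
      · rw [hg]; dsimp only
        exact indicator_of_notMem (h z hz) _
  have hsI : IntervalIntegrable (fun t => ∑ z ∈ Z, g z t) volume t₁ t₂ := by
    have hfun : (fun t => ∑ z ∈ Z, g z t) = ∑ z ∈ Z, g z := by
      funext t
      rw [Finset.sum_apply]
    rw [hfun]
    exact IntervalIntegrable.sum Z hgI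
  calc ∑ z ∈ Z, (c z : ℝ) * (2 * w z) = ∑ z ∈ Z, ∫ t in t₁..t₂, g z t :=
        Finset.sum_congr rfl fun z hz => (hgint z hz).symm
    _ = ∫ t in t₁..t₂, ∑ z ∈ Z, g z t := (intervalIntegral.integral_finsetSum hgI).symm
    _ ≤ ∫ t in t₁..t₂, f t := intervalIntegral.integral_mono_on ht hsI hf hle

open Polynomial in
/-- Near a point `a`, a non-zero complex polynomial is `O(|t - a|^k)` along the real axis, `k` the
multiplicity of `a` as a root. -/
theorem coareaPt_norm_eval_le {p : ℂ[X]} (hp : p ≠ 0) (a : ℝ) :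
    ∃ C : ℝ, ∀ t : ℝ, |t - a| ≤ 1 → ‖p.eval (t : ℂ)‖ ≤ C * |t - a| ^ (p.roots.count (a : ℂ)) := by
  rw [count_roots]
  obtain ⟨q, hpq, -⟩ := exists_eq_pow_rootMultiplicity_mul_and_not_dvd p hp (a : ℂ)
  set k := rootMultiplicity (a : ℂ) p with hk
  obtain ⟨C, hC⟩ := (isCompact_Icc : IsCompact (Icc (a - 1) (a + 1))).exists_bound_of_continuousOn
    (f := fun t : ℝ => q.eval (t : ℂ)) (q.continuous.comp Complex.continuous_ofReal).continuousOn
  refine ⟨C, fun t ht => ?_⟩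
  have hmem : t ∈ Icc (a - 1) (a + 1) := by
    constructor <;> cases abs_le.1 ht <;> linarith
  rw [hpq, eval_mul, eval_pow, eval_sub, eval_X, eval_C, norm_mul, norm_pow, ← Complex.ofReal_sub,
    Complex.norm_real, Real.norm_eq_abs, mul_comm]
  exact mul_le_mul_of_nonneg_right (hC t hmem) (pow_nonneg (abs_nonneg _) _)

/-- `c ε < a` for all small `ε > 0` (`a > 0`). -/
theorem coareaPt_eventually_mul_lt {a : ℝ} (ha : 0 < a) (c : ℝ) :
    ∀ᶠ ε in 𝓝[>] (0 : ℝ), c * ε < a := by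
  rcases le_or_gt c 0 with hc | hc
  · filter_upwards [self_mem_nhdsWithin] with ε hε
    exact lt_of_le_of_lt (mul_nonpos_of_nonpos_of_nonneg hc (le_of_lt hε)) ha
  · filter_upwards [Ioo_mem_nhdsGT (div_pos ha hc)] with ε hε
    exact (lt_div_iff₀' hc).1 hε.2

end MeasurePart

open scoped BigOperators Topology Classical MeasureTheory Matrix ComplexConjugate
open Filter MeasureTheory
open Literature.MathematicalPhysics.QuantumLattice Literature.MathematicalPhysics.QuantumFieldTheory
  Literature.Probability.LatticeModels
open Summit.QuantumFields.QCD.Theses.SpectralDefectExtinction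
open Summit.QuantumFields.QCD.Theorems.WindowExtinction.Negative

/-- **STUB 1 · `stub_coareaPointwise`** — pointwise coarea inequality with algebraic multiplicity:
for every torus, field `U` and open `(t₁,t₂)` there is `ε₀ > 0` such that for `0 < ε < ε₀`,
`2ε · #{real eigenvalues of D_W(U,0,1) in (t₁,t₂)} ≤ ∫_{t₁}^{t₂} #{eigenvalues of Γ₅ D_W(U,−t,1) in (−ε,ε)} dt`. -/
theorem stub_coareaPointwise :
    ∀ (L : ℕ) [NeZero L] (U : GaugeConfig 4 L SU3) (t₁ t₂ : ℝ), t₁ < t₂ → ∃ ε₀ : ℝ, 0 < ε₀ ∧ ∀ ε :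
      ℝ, 0 < ε → ε < ε₀ → 2 * ε * (Multiset.countP (fun z : ℂ => z.im = 0 ∧ t₁ < z.re ∧ z.re < t₂)
      (wilsonDirac (fundamentalRep (Fin 3)) U 0 1).charpoly.roots : ℝ) ≤ ∫ t in t₁..t₂,
      (Multiset.countP (fun z : ℂ => |z.re| < ε) (spinorLift gammaFive * wilsonDirac (fundamentalRep
      (Fin 3)) U (-t) 1).charpoly.roots : ℝ) := by
  intro L _ U t₁ t₂ ht12
  have hρ : ∀ g : SU3, fundamentalRep (Fin 3) g ∈ Matrix.unitaryGroup (Fin 3) ℂ :=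
    fundamentalRep_mem_unitaryGroup
  set D : Matrix (QuarkIdx L) (QuarkIdx L) ℂ := wilsonDirac (fundamentalRep (Fin 3)) U 0 1 with hDdef
  set Γ : Matrix (QuarkIdx L) (QuarkIdx L) ℂ := spinorLift gammaFive with hΓdef
  have hΓh : Γᴴ = Γ :=
    Literature.Barriers.QuantumFields.WilsonDeterminant.conjTranspose_spinorLift_gammaFive
  have hΓ2 : Γ * Γ = 1 := spinorLift_gammaFive_mul_self
  have hΓD : (Γ * D)ᴴ = Γ * D :=
    Literature.Barriers.QuantumFields.isHermitian_gammaFive_mul_wilsonDirac _ hρ U 0 1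
  -- the Hermitian flow `H(t) = Γ₅ D_W(U,-t,1) = Γ D - t Γ`
  have hH : ∀ t : ℝ,
      (spinorLift gammaFive * wilsonDirac (fundamentalRep (Fin 3)) U (-t) 1).IsHermitian :=
    fun t => Literature.Barriers.QuantumFields.isHermitian_gammaFive_mul_wilsonDirac _ hρ U (-t) 1
  have hpen : ∀ t : ℝ, spinorLift gammaFive * wilsonDirac (fundamentalRep (Fin 3)) U (-t) 1 =
      Γ * D + ((-t : ℝ) : ℂ) • Γ :=
    fun t => hermitianWilsonDirac_eq_pencil _ hρ U (-t)
  -- `Γ₅` is an isometry, so the flow is `1`-Lipschitz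
  have hiso : ∀ x : EuclideanSpace ℂ (QuarkIdx L), ‖Matrix.toEuclideanLin Γ x‖ = ‖x‖ := fun x => by
    rw [EuclideanSpace.norm_eq, EuclideanSpace.norm_eq]
    congr 1
    have hΓΓ : Γᴴ * Γ = 1 := by rw [hΓh]; exact hΓ2
    exact sum_norm_sq_mulVec_of_isometry hΓΓ (WithLp.ofLp x)
  have hLip : ∀ (t t' : ℝ) (x : EuclideanSpace ℂ (QuarkIdx L)),
      ‖Matrix.toEuclideanLin (spinorLift gammaFive * wilsonDirac (fundamentalRep (Fin 3)) U (-t') 1) x -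
        Matrix.toEuclideanLin (spinorLift gammaFive * wilsonDirac (fundamentalRep (Fin 3)) U (-t) 1) x‖ ≤
        |t' - t| * ‖x‖ := by
    intro t t' x
    rw [← LinearMap.sub_apply, ← map_sub, hpen t', hpen t, add_sub_add_left_eq_sub, ← sub_smul,
      ← Complex.ofReal_sub, LinearEquiv.map_smul, LinearMap.smul_apply, norm_smul, Complex.norm_real,
      Real.norm_eq_abs, hiso, neg_sub_neg, abs_sub_comm]
  -- `|det H(t)| = |charpoly_D(t)|`
  have hdetH : ∀ t : ℝ, ‖(spinorLift gammaFive * wilsonDirac (fundamentalRep (Fin 3)) U (-t) 1).det‖ =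
      ‖D.charpoly.eval (t : ℂ)‖ := by
    intro t
    have hmat : Matrix.scalar (QuarkIdx L) (t : ℂ) - D = -(D + Matrix.scalar (QuarkIdx L) ((-t : ℝ) : ℂ)) := by
      rw [Complex.ofReal_neg, map_neg]; abel
    rw [Matrix.det_mul, Literature.Barriers.QuantumFields.WilsonDeterminant.det_spinorLift_gammaFive, one_mul,
      wilsonDirac_mass_eq_add_scalar _ U (-t) 1, Matrix.eval_charpoly, hmat, Matrix.det_neg, norm_mul,
      norm_pow, norm_neg, norm_one, one_pow, one_mul]
  -- the window count as an eigenvalue count, and its integrability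
  have hN : ∀ t ε : ℝ, Multiset.countP (fun z : ℂ => |z.re| < ε)
      (spinorLift gammaFive * wilsonDirac (fundamentalRep (Fin 3)) U (-t) 1).charpoly.roots =
      (Finset.univ.filter fun i => |(hH t).eigenvalues i| < ε).card :=
    fun t ε => countP_roots_eq_card_filter (hH t) (fun x => |x| < ε)
  have hint : ∀ ε : ℝ, IntervalIntegrable
      (fun t => (((Finset.univ.filter fun i => |(hH t).eigenvalues i| < ε).card : ℕ) : ℝ)) volume t₁ t₂ := by
    intro ε
    refine coareaPt_intervalIntegrable_of_bounded (coareaPt_measurable_card hH hLip ε)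
      (M := Fintype.card (QuarkIdx L)) (fun t => ?_) t₁ t₂
    rw [Real.norm_natCast]
    exact_mod_cast (Finset.card_filter_le _ _).trans (Finset.card_univ (α := QuarkIdx L)).le
  -- the distinct real eigenvalues in the window
  set Z : Finset ℂ := (D.charpoly.roots.filter fun z : ℂ => z.im = 0 ∧ t₁ < z.re ∧ z.re < t₂).toFinset
    with hZdef
  have hZ : ∀ z ∈ Z, z ∈ D.charpoly.roots ∧ z.im = 0 ∧ t₁ < z.re ∧ z.re < t₂ := fun z hz => by
    have h := Multiset.mem_toFinset.1 hz
    rw [Multiset.mem_filter] at h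
    exact h
  have hzeq : ∀ z ∈ Z, z = ((z.re : ℝ) : ℂ) := fun z hz =>
    Complex.ext (by simp) (by simp [(hZ z hz).2.1])
  have hcount : (Multiset.countP (fun z : ℂ => z.im = 0 ∧ t₁ < z.re ∧ z.re < t₂) D.charpoly.roots : ℝ) =
      ∑ z ∈ Z, (D.charpoly.roots.count z : ℝ) := by
    have h : Multiset.countP (fun z : ℂ => z.im = 0 ∧ t₁ < z.re ∧ z.re < t₂) D.charpoly.roots =
        ∑ z ∈ Z, D.charpoly.roots.count z := by
      rw [Multiset.countP_eq_card_filter, ← Multiset.toFinset_sum_count_eq]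
      exact Finset.sum_congr rfl fun z hz => Multiset.count_filter_of_pos (hZ z hz).2
    exact_mod_cast h
  have hkn : ∀ z ∈ Z, D.charpoly.roots.count z ≤ Fintype.card (QuarkIdx L) := fun z _ =>
    (Multiset.count_le_card z _).trans
      ((Polynomial.card_roots' _).trans (Matrix.charpoly_natDegree_eq_dim D).le)
  -- the window around each real eigenvalue
  have hroot : ∀ z ∈ Z, ∀ᶠ ε in 𝓝[>] (0 : ℝ), ∃ (c : ℕ) (w : ℝ), 0 < w ∧
      w ≤ (D.charpoly.roots.count z : ℕ) * ε ∧ (c : ℝ) * w = (D.charpoly.roots.count z : ℕ) * ε ∧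
      ∀ t, |t - z.re| < w → c ≤ (Finset.univ.filter fun i => |(hH t).eigenvalues i| < ε).card := by
    intro z hz
    have hk1 : 1 ≤ D.charpoly.roots.count z := Multiset.one_le_count_iff_mem.2 (hZ z hz).1
    -- geometric multiplicity ≤ algebraic multiplicity
    have hgk : (Finset.univ.filter fun i => (hH z.re).eigenvalues i = 0).card ≤
        D.charpoly.roots.count z := by
      have h := pencil_zero_count_le (D := D) hΓh hΓ2 hΓD (-z.re)
      rw [← hpen z.re, countP_roots_eq_card_filter (hH z.re) (· = 0), Complex.ofReal_neg, neg_neg,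
        ← hzeq z hz] at h
      exact h
    -- `|det H(t)| = |charpoly_D(t)| ≤ C |t - λ|^k`
    have hC := coareaPt_norm_eval_le (Matrix.charpoly_monic D).ne_zero z.re
    rw [← hzeq z hz] at hC
    obtain ⟨C, hC⟩ := hC
    exact coareaPt_root_window hH hLip z.re hk1 hgk ⟨C, fun t ht => by rw [hdetH]; exact hC t ht⟩
  -- separation of the windows: all small `ε`
  have hsep : ∀ᶠ ε in 𝓝[>] (0 : ℝ), ∀ z ∈ Z, ∀ z' ∈ Z, z ≠ z' →
      2 * (Fintype.card (QuarkIdx L) : ℝ) * ε ≤ |z.re - z'.re| := by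
    refine (Finset.eventually_all Z).2 fun z hz => (Finset.eventually_all Z).2 fun z' hz' => ?_
    by_cases hzz : z = z'
    · exact Eventually.of_forall fun ε h => absurd hzz h
    · have hne : z.re - z'.re ≠ 0 := fun h => hzz (by rw [hzeq z hz, hzeq z' hz', sub_eq_zero.1 h])
      filter_upwards [coareaPt_eventually_mul_lt (abs_pos.2 hne) (2 * (Fintype.card (QuarkIdx L) : ℝ))]
        with ε hε
      exact fun _ => hε.le
  have hbd : ∀ᶠ ε in 𝓝[>] (0 : ℝ), ∀ z ∈ Z, (Fintype.card (QuarkIdx L) : ℝ) * ε ≤ z.re - t₁ ∧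
      (Fintype.card (QuarkIdx L) : ℝ) * ε ≤ t₂ - z.re := by
    refine (Finset.eventually_all Z).2 fun z hz => ?_
    filter_upwards [coareaPt_eventually_mul_lt (sub_pos.2 (hZ z hz).2.2.1) (Fintype.card (QuarkIdx L) : ℝ),
      coareaPt_eventually_mul_lt (sub_pos.2 (hZ z hz).2.2.2) (Fintype.card (QuarkIdx L) : ℝ)] with ε h1 h2
    exact ⟨h1.le, h2.le⟩
  -- choose `ε₀`
  obtain ⟨ε₀, hε₀, hε₀P⟩ :=
    coareaPt_exists_of_eventually (((Finset.eventually_all Z).2 hroot).and (hsep.and hbd))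
  refine ⟨ε₀, hε₀, fun ε hε hεε₀ => ?_⟩
  obtain ⟨hr, hs, hb⟩ := hε₀P ε hε hεε₀
  choose! c w hcw using hr
  rw [hΓdef]
  simp_rw [hN]
  rw [hcount]
  have hwn : ∀ z ∈ Z, w z ≤ (Fintype.card (QuarkIdx L) : ℝ) * ε := fun z hz =>
    (hcw z hz).2.1.trans (mul_le_mul_of_nonneg_right (by exact_mod_cast hkn z hz) hε.le)
  calc 2 * ε * ∑ z ∈ Z, (D.charpoly.roots.count z : ℝ) = ∑ z ∈ Z, (c z : ℝ) * (2 * w z) := by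
        rw [Finset.mul_sum]
        refine Finset.sum_congr rfl fun z hz => ?_
        rw [mul_left_comm, (hcw z hz).2.2.1]
        ring
    _ ≤ ∫ t in t₁..t₂, (((Finset.univ.filter fun i => |(hH t).eigenvalues i| < ε).card : ℕ) : ℝ) :=
        coareaPt_sum_le_integral Z (fun z => z.re) w c ht12.le (hint ε) (fun t => Nat.cast_nonneg _)
          (fun z hz => (hcw z hz).1.le)
          (fun z hz => ⟨by linarith [hwn z hz, (hb z hz).1], by linarith [hwn z hz, (hb z hz).2]⟩)
          (fun z hz z' hz' hne => by linarith [hwn z hz, hwn z' hz', hs z hz z' hz' hne])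
          (fun z hz t ht => by exact_mod_cast (hcw z hz).2.2.2 t ht)

end Summit.QuantumFields.QCD.Cruxes.TipPricing.HermitianFlowCoarea

end
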